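import Mathlib
import HarnessLib
import Summits.ResolutionOfSingularities.ResolutionOfSingularities.Theorems.WildQuotientsWildQuotientResolutionS1aQhSymChartIterates
import Summits.ResolutionOfSingularities.ResolutionOfSingularities.Theorems.WildQuotientsWildQuotientResolutionS1aCuspMemberZ
import Summits.ResolutionOfSingularities.ResolutionOfSingularities.Theorems.WildQuotientsWildQuotientResolutionS1aGraphMemberAway

/-!
# S1a — R4c cusp, brick (b5-Z/iterates): the `Q`-side member element `ĥ_Q = e·u₁′ + 2s·u₂′ − 3s·u₁′²` in `R^w` (bidegree `(1,0)` for `w = (3,1,2)`), the closed form of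
`τ′ʲ y′`, and the polynomial images of the intrinsic norms `N_R(u₁′)`, `N_R(ĥ_Q)` in the pinned chart model (one moving generator, ✓QhRoot datum)

[OURS · L1 W4.5c · lead-1 g17; plan-1 RULING R-F15v (2) ★ R4c `cusp_killsIn_two`, memo `Cruxes/CyclicQuotientFourfolds/Lines/s1a_logminvertex-R4c-PROGRESS.md` §2/§4:
`Q`-side companion of ✓CuspMemberZ / ✓QhSymChartIterates for the member charts `U_{Q,1}`, `U_{Q,2}` (generic fixedness / bidegree of intrinsic norms: ✓`QhSym.sigmaR_normR_fixed`,
✓`QhSym.normR_mem_reesPiece` apply verbatim)] — NOT statements of the manuscript; counted 0; AI-level work, weaker than expert review. Crux stmt-ResolutionOfSingularities-17941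
`CyclicQuotientFourfolds`, line `s1a-logminvertex` v13 (`stub_reachLowerInFX`).
-/

set_option linter.dupNamespace false

noncomputable section

open MvPolynomial
open Literature.AlgebraicGeometry.Resolution
open scoped LaurentPolynomial
open Summit.ResolutionOfSingularities.ResolutionOfSingularities.Theorems.WildQuotientResolution.S1
open Summit.ResolutionOfSingularities.ResolutionOfSingularities.Theorems.WildQuotientResolution.S1.CoarseChart
open Summit.ResolutionOfSingularities.ResolutionOfSingularities.Theorems.WildQuotientResolution.S1.ProducerStep
open Summit.ResolutionOfSingularities.ResolutionOfSingularities.Theorems.WildQuotientResolution.S1.ReesBigrading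
open Summit.ResolutionOfSingularities.ResolutionOfSingularities.Theorems.WildQuotientResolution.S1.NodeTransport
open Summit.ResolutionOfSingularities.ResolutionOfSingularities.Theorems.WildQuotientResolution.S1.CobordantTransport
open Summit.ResolutionOfSingularities.ResolutionOfSingularities.Theorems.WildQuotientResolution.S1.NodeAway
open Summit.ResolutionOfSingularities.ResolutionOfSingularities.Theorems.WildQuotientResolution.S1.CentreAway
open Summit.ResolutionOfSingularities.ResolutionOfSingularities.Theorems.WildQuotientResolution.S1.BlowupCharts
open Summit.ResolutionOfSingularities.ResolutionOfSingularities.Theorems.WildQuotientResolution.S1.KillCert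
open Summit.ResolutionOfSingularities.ResolutionOfSingularities.Theorems.WildQuotientResolution.S1.GameFrame.GModel

namespace Summit.ResolutionOfSingularities.ResolutionOfSingularities.Theorems.WildQuotientResolution.S1.KillCert.QhAway

variable {k : Type} [Field k] (σ : (MvPolynomial (Fin 4) k) ≃+* (MvPolynomial (Fin 4) k)) (hC : ∀ a : k, σ (C a) = C a)
  (h0 : σ (X 0) = X 0) (h1 : σ (X 1) = X 1 + X 0) (h2 : σ (X 2) = X 2) (t₀ : (MvPolynomial (Fin 4) k)) (h3 : σ (X 3) = X 3 + t₀)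
  (w : Fin 3 → ℕ) (sh : ℕ) (hw0 : w 0 = w 1 + sh) (hh : (MvPolynomial (Fin 4) k)) (hσh : σ hh = hh)
  {p : ℕ} (hp : 0 < p) (hσpL : ∀ y : (Localization.Away hh), (⇑(sigmaAway σ hσh))^[p] y = y)
  (hσJ : ∀ n : ℕ, ((weightedFiltration (fun i => algebraMap (MvPolynomial (Fin 4) k) (Localization.Away hh) (X ((![0, 1, 2] : Fin 3 → Fin 4) i))) w).ideal n).map ((sigmaAway σ hσh) : (Localization.Away hh) →+* (Localization.Away hh)) ≤ (weightedFiltration (fun i => algebraMap (MvPolynomial (Fin 4) k) (Localization.Away hh) (X ((![0, 1, 2] : Fin 3 → Fin 4) i))) w).ideal n)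
  {mg : ℕ} (mo : Fin mg → ℕ) (𝒜 : (Π j : Fin mg, ZMod (mo j)) → AddSubgroup (Localization.Away hh)) [GradedRing 𝒜]
  {dbar : ℕ} (y : ↥(𝒜 0)) (hy : y ∈ (traceFiltration 𝒜 (fun i => algebraMap (MvPolynomial (Fin 4) k) (Localization.Away hh) (X ((![0, 1, 2] : Fin 3 → Fin 4) i))) w).ideal dbar) (hσy : (sigmaAway σ hσh) (y : (Localization.Away hh)) = y)
  {P : Type} [CommRing P] [Algebra (MvPolynomial (Option (Fin 4)) k) P] (Φ : (ChartRing 𝒜 (fun i => algebraMap (MvPolynomial (Fin 4) k) (Localization.Away hh) (X ((![0, 1, 2] : Fin 3 → Fin 4) i))) w dbar y hy) ≃+* P)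
  (hΦa : ∀ a : (MvPolynomial (Fin 4) k), Φ ((algebraMap ↥(cobordantAlgebra (fun i => algebraMap (MvPolynomial (Fin 4) k) (Localization.Away hh) (X ((![0, 1, 2] : Fin 3 → Fin 4) i))) w) (ChartRing 𝒜 (fun i => algebraMap (MvPolynomial (Fin 4) k) (Localization.Away hh) (X ((![0, 1, 2] : Fin 3 → Fin 4) i))) w dbar y hy)) (algebraMap (Localization.Away hh) ↥(cobordantAlgebra (fun i => algebraMap (MvPolynomial (Fin 4) k) (Localization.Away hh) (X ((![0, 1, 2] : Fin 3 → Fin 4) i))) w) (algebraMap (MvPolynomial (Fin 4) k) (Localization.Away hh) a))) = (algebraMap (MvPolynomial (Option (Fin 4)) k) P) (cobordantAlgebra.subst k (![w 0, w 1, w 2, 0] : Fin 4 → ℕ) a))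
  (hΦs : Φ ((algebraMap ↥(cobordantAlgebra (fun i => algebraMap (MvPolynomial (Fin 4) k) (Localization.Away hh) (X ((![0, 1, 2] : Fin 3 → Fin 4) i))) w) (ChartRing 𝒜 (fun i => algebraMap (MvPolynomial (Fin 4) k) (Localization.Away hh) (X ((![0, 1, 2] : Fin 3 → Fin 4) i))) w dbar y hy)) (cobordantAlgebra.s (fun i => algebraMap (MvPolynomial (Fin 4) k) (Localization.Away hh) (X ((![0, 1, 2] : Fin 3 → Fin 4) i))) w)) = (algebraMap (MvPolynomial (Option (Fin 4)) k) P) (X none))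
  (hΦu : ∀ i : Fin 3, Φ ((algebraMap ↥(cobordantAlgebra (fun i => algebraMap (MvPolynomial (Fin 4) k) (Localization.Away hh) (X ((![0, 1, 2] : Fin 3 → Fin 4) i))) w) (ChartRing 𝒜 (fun i => algebraMap (MvPolynomial (Fin 4) k) (Localization.Away hh) (X ((![0, 1, 2] : Fin 3 → Fin 4) i))) w dbar y hy)) (cobordantAlgebra.u' (fun i => algebraMap (MvPolynomial (Fin 4) k) (Localization.Away hh) (X ((![0, 1, 2] : Fin 3 → Fin 4) i))) w i)) = (algebraMap (MvPolynomial (Option (Fin 4)) k) P) (X (some ((![0, 1, 2] : Fin 3 → Fin 4) i))))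


/-- **`ĥ_Q = e·u₁′ + 2s·u₂′ − 3s·u₁′²` has bidegree `(1, 0)`** for the weights `w = (3, 1, 2)` of the root at `Q` (`e` a constant of degree `0`). [OURS · L1 W4.5c · R4c] -/
theorem hHatQ_mem_reesPiece (hf : ∀ i, (fun i => algebraMap (MvPolynomial (Fin 4) k) (Localization.Away hh) (X ((![0, 1, 2] : Fin 3 → Fin 4) i))) i ∈ 𝒜 ((fun _ => (0 : Π j : Fin mg, ZMod (mo j))) i)) (h𝒜 : ∀ x : (Localization.Away hh), x ∈ 𝒜 0) (e : k)
    (hw1 : w 1 = 1) (hw2' : w 2 = 2) :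
    ((algebraMap (Localization.Away hh) ↥(cobordantAlgebra (fun i => algebraMap (MvPolynomial (Fin 4) k) (Localization.Away hh) (X ((![0, 1, 2] : Fin 3 → Fin 4) i))) w) (algebraMap (MvPolynomial (Fin 4) k) (Localization.Away hh) (C e))) * (cobordantAlgebra.u' (fun i => algebraMap (MvPolynomial (Fin 4) k) (Localization.Away hh) (X ((![0, 1, 2] : Fin 3 → Fin 4) i))) w 1) + 2 * (cobordantAlgebra.s (fun i => algebraMap (MvPolynomial (Fin 4) k) (Localization.Away hh) (X ((![0, 1, 2] : Fin 3 → Fin 4) i))) w) * (cobordantAlgebra.u' (fun i => algebraMap (MvPolynomial (Fin 4) k) (Localization.Away hh) (X ((![0, 1, 2] : Fin 3 → Fin 4) i))) w 2) - 3 * (cobordantAlgebra.s (fun i => algebraMap (MvPolynomial (Fin 4) k) (Localization.Away hh) (X ((![0, 1, 2] : Fin 3 → Fin 4) i))) w) * (cobordantAlgebra.u' (fun i => algebraMap (MvPolynomial (Fin 4) k) (Localization.Away hh) (X ((![0, 1, 2] : Fin 3 → Fin 4) i))) w 1) ^ 2 : ↥(cobordantAlgebra (fun i => algebraMap (MvPolynomial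 (Fin 4) k) (Localization.Away hh) (X ((![0, 1, 2] : Fin 3 → Fin 4) i))) w)) ∈ reesPiece 𝒜 (fun i => algebraMap (MvPolynomial (Fin 4) k) (Localization.Away hh) (X ((![0, 1, 2] : Fin 3 → Fin 4) i))) w (((1 : ℕ) : ℤ), (0 : Π j : Fin mg, ZMod (mo j))) := by
  letI := reesGradedRing 𝒜 (fun i => algebraMap (MvPolynomial (Fin 4) k) (Localization.Away hh) (X ((![0, 1, 2] : Fin 3 → Fin 4) i))) w hf
  have hu2 : (cobordantAlgebra.u' (fun i => algebraMap (MvPolynomial (Fin 4) k) (Localization.Away hh) (X ((![0, 1, 2] : Fin 3 → Fin 4) i))) w 2) ∈ reesPiece 𝒜 (fun i => algebraMap (MvPolynomial (Fin 4) k) (Localization.Away hh) (X ((![0, 1, 2] : Fin 3 → Fin 4) i))) w (((2 : ℕ) : ℤ), (0 : Π j : Fin mg, ZMod (mo j))) := by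
    have h := u'_mem_reesPiece 𝒜 (fun i => algebraMap (MvPolynomial (Fin 4) k) (Localization.Away hh) (X ((![0, 1, 2] : Fin 3 → Fin 4) i))) (δ := fun _ => (0 : Π j : Fin mg, ZMod (mo j))) w hf 2
    rwa [hw2'] at h
  have hu1 : (cobordantAlgebra.u' (fun i => algebraMap (MvPolynomial (Fin 4) k) (Localization.Away hh) (X ((![0, 1, 2] : Fin 3 → Fin 4) i))) w 1) ∈ reesPiece 𝒜 (fun i => algebraMap (MvPolynomial (Fin 4) k) (Localization.Away hh) (X ((![0, 1, 2] : Fin 3 → Fin 4) i))) w (((1 : ℕ) : ℤ), (0 : Π j : Fin mg, ZMod (mo j))) := by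
    have h := u'_mem_reesPiece 𝒜 (fun i => algebraMap (MvPolynomial (Fin 4) k) (Localization.Away hh) (X ((![0, 1, 2] : Fin 3 → Fin 4) i))) (δ := fun _ => (0 : Π j : Fin mg, ZMod (mo j))) w hf 1
    rwa [hw1] at h
  have hs : (cobordantAlgebra.s (fun i => algebraMap (MvPolynomial (Fin 4) k) (Localization.Away hh) (X ((![0, 1, 2] : Fin 3 → Fin 4) i))) w) ∈ reesPiece 𝒜 (fun i => algebraMap (MvPolynomial (Fin 4) k) (Localization.Away hh) (X ((![0, 1, 2] : Fin 3 → Fin 4) i))) w (-1, (0 : Π j : Fin mg, ZMod (mo j))) := s_mem_reesPiece 𝒜 (fun i => algebraMap (MvPolynomial (Fin 4) k) (Localization.Away hh) (X ((![0, 1, 2] : Fin 3 → Fin 4) i))) w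
  have hce : (algebraMap (Localization.Away hh) ↥(cobordantAlgebra (fun i => algebraMap (MvPolynomial (Fin 4) k) (Localization.Away hh) (X ((![0, 1, 2] : Fin 3 → Fin 4) i))) w) (algebraMap (MvPolynomial (Fin 4) k) (Localization.Away hh) (C e))) ∈ reesPiece 𝒜 (fun i => algebraMap (MvPolynomial (Fin 4) k) (Localization.Away hh) (X ((![0, 1, 2] : Fin 3 → Fin 4) i))) w (0, (0 : Π j : Fin mg, ZMod (mo j))) := algebraMap_mem_reesPiece 𝒜 (fun i => algebraMap (MvPolynomial (Fin 4) k) (Localization.Away hh) (X ((![0, 1, 2] : Fin 3 → Fin 4) i))) w (h𝒜 _)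
  have h2 : (2 : ↥(cobordantAlgebra (fun i => algebraMap (MvPolynomial (Fin 4) k) (Localization.Away hh) (X ((![0, 1, 2] : Fin 3 → Fin 4) i))) w)) ∈ reesPiece 𝒜 (fun i => algebraMap (MvPolynomial (Fin 4) k) (Localization.Away hh) (X ((![0, 1, 2] : Fin 3 → Fin 4) i))) w 0 := SetLike.natCast_mem_graded _ 2
  have h3 : (3 : ↥(cobordantAlgebra (fun i => algebraMap (MvPolynomial (Fin 4) k) (Localization.Away hh) (X ((![0, 1, 2] : Fin 3 → Fin 4) i))) w)) ∈ reesPiece 𝒜 (fun i => algebraMap (MvPolynomial (Fin 4) k) (Localization.Away hh) (X ((![0, 1, 2] : Fin 3 → Fin 4) i))) w 0 := SetLike.natCast_mem_graded _ 3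
  have hA : (algebraMap (Localization.Away hh) ↥(cobordantAlgebra (fun i => algebraMap (MvPolynomial (Fin 4) k) (Localization.Away hh) (X ((![0, 1, 2] : Fin 3 → Fin 4) i))) w) (algebraMap (MvPolynomial (Fin 4) k) (Localization.Away hh) (C e))) * (cobordantAlgebra.u' (fun i => algebraMap (MvPolynomial (Fin 4) k) (Localization.Away hh) (X ((![0, 1, 2] : Fin 3 → Fin 4) i))) w 1) ∈ reesPiece 𝒜 (fun i => algebraMap (MvPolynomial (Fin 4) k) (Localization.Away hh) (X ((![0, 1, 2] : Fin 3 → Fin 4) i))) w (((1 : ℕ) : ℤ), (0 : Π j : Fin mg, ZMod (mo j))) := by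
    have h := SetLike.mul_mem_graded hce hu1
    rwa [show ((0 : ℤ), (0 : Π j : Fin mg, ZMod (mo j))) + (((1 : ℕ) : ℤ), (0 : Π j : Fin mg, ZMod (mo j))) = (((1 : ℕ) : ℤ), (0 : Π j : Fin mg, ZMod (mo j))) from
      Prod.ext (zero_add _) (zero_add _)] at h
  have hB : 2 * (cobordantAlgebra.s (fun i => algebraMap (MvPolynomial (Fin 4) k) (Localization.Away hh) (X ((![0, 1, 2] : Fin 3 → Fin 4) i))) w) * (cobordantAlgebra.u' (fun i => algebraMap (MvPolynomial (Fin 4) k) (Localization.Away hh) (X ((![0, 1, 2] : Fin 3 → Fin 4) i))) w 2) ∈ reesPiece 𝒜 (fun i => algebraMap (MvPolynomial (Fin 4) k) (Localization.Away hh) (X ((![0, 1, 2] : Fin 3 → Fin 4) i))) w (((1 : ℕ) : ℤ), (0 : Π j : Fin mg, ZMod (mo j))) := by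
    have h := SetLike.mul_mem_graded (SetLike.mul_mem_graded h2 hs) hu2
    have e1 : (0 : ℤ × (Π j : Fin mg, ZMod (mo j))) + (-1, (0 : Π j : Fin mg, ZMod (mo j))) + (((2 : ℕ) : ℤ), (0 : Π j : Fin mg, ZMod (mo j))) = (((1 : ℕ) : ℤ), (0 : Π j : Fin mg, ZMod (mo j))) := by
      refine Prod.ext ?_ ?_
      · change (0 : ℤ) + -1 + ((2 : ℕ) : ℤ) = ((1 : ℕ) : ℤ); norm_num
      · change ((0 : Π j : Fin mg, ZMod (mo j)) + 0) + 0 = 0; rw [add_zero, add_zero]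
    rwa [e1] at h
  have hC' : 3 * (cobordantAlgebra.s (fun i => algebraMap (MvPolynomial (Fin 4) k) (Localization.Away hh) (X ((![0, 1, 2] : Fin 3 → Fin 4) i))) w) * (cobordantAlgebra.u' (fun i => algebraMap (MvPolynomial (Fin 4) k) (Localization.Away hh) (X ((![0, 1, 2] : Fin 3 → Fin 4) i))) w 1) ^ 2 ∈ reesPiece 𝒜 (fun i => algebraMap (MvPolynomial (Fin 4) k) (Localization.Away hh) (X ((![0, 1, 2] : Fin 3 → Fin 4) i))) w (((1 : ℕ) : ℤ), (0 : Π j : Fin mg, ZMod (mo j))) := by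
    have h := SetLike.mul_mem_graded (SetLike.mul_mem_graded h3 hs) (SetLike.pow_mem_graded 2 hu1)
    have e1 : (0 : ℤ × (Π j : Fin mg, ZMod (mo j))) + (-1, (0 : Π j : Fin mg, ZMod (mo j))) + 2 • (((1 : ℕ) : ℤ), (0 : Π j : Fin mg, ZMod (mo j))) = (((1 : ℕ) : ℤ), (0 : Π j : Fin mg, ZMod (mo j))) := by
      refine Prod.ext ?_ ?_
      · change (0 : ℤ) + -1 + 2 • (((1 : ℕ) : ℤ)) = ((1 : ℕ) : ℤ); norm_num
      · change ((0 : Π j : Fin mg, ZMod (mo j)) + 0) + 2 • (0 : Π j : Fin mg, ZMod (mo j)) = 0; rw [add_zero, smul_zero, add_zero]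
    rwa [e1] at h
  exact sub_mem (add_mem hA hB) hC'

set_option maxHeartbeats 1600000 in
include h0 h1 h2 h3 hC hw0 hΦa hΦs hΦu in
/-- Closed form: `τ′ʲ x′₁ = x′₁ + j·x_none^sh x′₀` (one moving generator). [OURS · L1 W4.5c · R4c] -/
theorem qhc_iterate_X1 (j : ℕ) :
    (⇑(conj Φ (sigmaChart 𝒜 (fun i => algebraMap (MvPolynomial (Fin 4) k) (Localization.Away hh) (X ((![0, 1, 2] : Fin 3 → Fin 4) i))) w dbar y hy (sigmaAway σ hσh) hσJ hp hσpL hσy)))^[j] ((algebraMap (MvPolynomial (Option (Fin 4)) k) P) (X (some 1))) = (algebraMap (MvPolynomial (Option (Fin 4)) k) P) (X (some 1)) + (j : P) * ((algebraMap (MvPolynomial (Option (Fin 4)) k) P) (X none) ^ sh * (algebraMap (MvPolynomial (Option (Fin 4)) k) P) (X (some 0))) := by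
  obtain ⟨rn, r0, -, -⟩ := qhc_rows_fixed σ hC h0 h1 h2 t₀ h3 w hh hσh hp hσpL hσJ mo 𝒜 y hy hσy Φ hΦa hΦs hΦu
  have r1 := qhc_row_one σ h0 h1 h2 t₀ h3 w sh hw0 hh hσh hp hσpL hσJ mo 𝒜 y hy hσy Φ hΦs hΦu
  induction j with
  | zero => simp
  | succ j ih =>
    rw [Function.iterate_succ_apply', ih, map_add, map_mul, map_natCast, map_mul, map_pow, r1, rn, r0]
    push_cast
    ring

set_option maxHeartbeats 1600000 in
set_option synthInstance.maxHeartbeats 400000 in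
include h0 h1 h2 h3 hC hw0 hΦa hΦs hΦu hσy in
/-- **Image of the intrinsic norm of `u₁′`**: `Φ(N_R(u₁′)/1) = ∏ₗ (x′₁ + l·x_none^sh x′₀)` (`= N(y′)` at `Q`). [OURS · L1 W4.5c · R4c] -/
theorem qhc_map_normR_u1 [NeZero p] :
    Φ ((algebraMap ↥(cobordantAlgebra (fun i => algebraMap (MvPolynomial (Fin 4) k) (Localization.Away hh) (X ((![0, 1, 2] : Fin 3 → Fin 4) i))) w) (ChartRing 𝒜 (fun i => algebraMap (MvPolynomial (Fin 4) k) (Localization.Away hh) (X ((![0, 1, 2] : Fin 3 → Fin 4) i))) w dbar y hy)) (∏ j : ZMod p, (⇑(sigmaR (sigmaAway σ hσh) (fun i => algebraMap (MvPolynomial (Fin 4) k) (Localization.Away hh) (X ((![0, 1, 2] : Fin 3 → Fin 4) i))) w hσJ hp hσpL))^[j.val] (cobordantAlgebra.u' (fun i => algebraMap (MvPolynomial (Fin 4) k) (Localization.Away hh) (X ((![0, 1, 2] : Fin 3 → Fin 4) i))) w 1))) = (algebraMap (MvPolynomial (Option (Fin 4)) k) P) (∏ j : ZMod p, (X (some 1)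 + (j.val : (MvPolynomial (Option (Fin 4)) k)) * (X none ^ sh * X (some 0)))) := by
  rw [map_prod, map_prod, map_prod]
  refine Finset.prod_congr rfl fun j _ => ?_
  have hu1 := hΦu 1
  change _ = (algebraMap (MvPolynomial (Option (Fin 4)) k) P) (X (some 1)) at hu1
  rw [QhSym.map_algebraMap_iterate_sigmaR (hσy := hσy), hu1, qhc_iterate_X1 σ hC h0 h1 h2 t₀ h3 w sh hw0 hh hσh hp hσpL hσJ mo 𝒜 y hy hσy Φ hΦa hΦs hΦu, map_add, map_mul,
    map_natCast, map_mul, map_pow]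

set_option maxHeartbeats 1600000 in
set_option synthInstance.maxHeartbeats 400000 in
include h0 h1 h2 h3 hC hw0 hΦa hΦs hΦu hσy in
/-- **Image of the intrinsic norm of `ĥ_Q`**: `Φ(N_R(ĥ_Q)/1) = ∏ₗ (e(x′₁ + l c) + 2x_none x′₂ − 3x_none(x′₁ + l c)²)`, `c = x_none^sh x′₀`. [OURS · L1 W4.5c · R4c] -/
theorem qhc_map_normR_hHatQ [NeZero p] (e : k) :
    Φ ((algebraMap ↥(cobordantAlgebra (fun i => algebraMap (MvPolynomial (Fin 4) k) (Localization.Away hh) (X ((![0, 1, 2] : Fin 3 → Fin 4) i))) w) (ChartRing 𝒜 (fun i => algebraMap (MvPolynomial (Fin 4) k) (Localization.Away hh) (X ((![0, 1, 2] : Fin 3 → Fin 4) i))) w dbar y hy)) (∏ j : ZMod p, (⇑(sigmaR (sigmaAway σ hσh) (fun i => algebraMap (MvPolynomial (Fin 4) k) (Localization.Away hh) (X ((![0, 1, 2] : Fin 3 → Fin 4) i))) w hσJ hp hσpL))^[j.val] ((algebraMap (Localization.Away hh) ↥(cobordantAlgebra (fun i => algebraMap (MvPolynomial (Fin 4) k)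 (Localization.Away hh) (X ((![0, 1, 2] : Fin 3 → Fin 4) i))) w) (algebraMap (MvPolynomial (Fin 4) k) (Localization.Away hh) (C e))) * (cobordantAlgebra.u' (fun i => algebraMap (MvPolynomial (Fin 4) k) (Localization.Away hh) (X ((![0, 1, 2] : Fin 3 → Fin 4) i))) w 1) + 2 * (cobordantAlgebra.s (fun i => algebraMap (MvPolynomial (Fin 4) k) (Localization.Away hh) (X ((![0, 1, 2] : Fin 3 → Fin 4) i))) w) * (cobordantAlgebra.u' (fun i => algebraMap (MvPolynomial (Fin 4) k) (Localization.Away hh) (X ((![0, 1, 2] : Fin 3 → Fin 4) i))) w 2) - 3 * (cobordantAlgebra.s (fun i => algebraMap (MvPolynomial (Fin 4) k) (Localization.Away hh) (X ((![0, 1, 2] : Fin 3 → Fin 4) i))) w) * (cobordantAlgebra.u' (fun i => algebraMap (MvPolynomial (Fin 4) k) (Localization.Away hh) (X ((![0, 1, 2] : Fin 3 → Fin 4) i))) w 1) ^ 2 : ↥(cobordantAlgebra (fun i => algebraMap (MvPolynomial (Fin 4) k) (Localization.Away hh) (X ((![0, 1, 2] : Fin 3 → Fin 4) i))) w)))) 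=
      (algebraMap (MvPolynomial (Option (Fin 4)) k) P) (∏ j : ZMod p, (C e * (X (some 1) + (j.val : (MvPolynomial (Option (Fin 4)) k)) * (X none ^ sh * X (some 0))) + 2 * X none * X (some 2) -
        3 * X none * (X (some 1) + (j.val : (MvPolynomial (Option (Fin 4)) k)) * (X none ^ sh * X (some 0))) ^ 2)) := by
  rw [map_prod, map_prod, map_prod]
  refine Finset.prod_congr rfl fun j _ => ?_
  have hu2 := hΦu 2
  change _ = (algebraMap (MvPolynomial (Option (Fin 4)) k) P) (X (some 2)) at hu2
  have hu1 := hΦu 1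
  change _ = (algebraMap (MvPolynomial (Option (Fin 4)) k) P) (X (some 1)) at hu1
  have hce : Φ ((algebraMap ↥(cobordantAlgebra (fun i => algebraMap (MvPolynomial (Fin 4) k) (Localization.Away hh) (X ((![0, 1, 2] : Fin 3 → Fin 4) i))) w) (ChartRing 𝒜 (fun i => algebraMap (MvPolynomial (Fin 4) k) (Localization.Away hh) (X ((![0, 1, 2] : Fin 3 → Fin 4) i))) w dbar y hy)) (algebraMap (Localization.Away hh) ↥(cobordantAlgebra (fun i => algebraMap (MvPolynomial (Fin 4) k) (Localization.Away hh) (X ((![0, 1, 2] : Fin 3 → Fin 4) i))) w) (algebraMap (MvPolynomial (Fin 4) k) (Localization.Away hh) (C e)))) = (algebraMap (MvPolynomial (Option (Fin 4)) k) P) (C e) := by rw [hΦa, cobordantAlgebra.subst, MvPolynomial.eval₂Hom_C]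
  have hX1 := qhc_iterate_X1 σ hC h0 h1 h2 t₀ h3 w sh hw0 hh hσh hp hσpL hσJ mo 𝒜 y hy hσy Φ hΦa hΦs hΦu j.val
  obtain ⟨rn, -, r2, rC⟩ := qhc_rows_fixed σ hC h0 h1 h2 t₀ h3 w hh hσh hp hσpL hσJ mo 𝒜 y hy hσy Φ hΦa hΦs hΦu
  have hXn : (⇑(conj Φ (sigmaChart 𝒜 (fun i => algebraMap (MvPolynomial (Fin 4) k) (Localization.Away hh) (X ((![0, 1, 2] : Fin 3 → Fin 4) i))) w dbar y hy (sigmaAway σ hσh) hσJ hp hσpL hσy)))^[j.val] ((algebraMap (MvPolynomial (Option (Fin 4)) k) P) (X none)) = (algebraMap (MvPolynomial (Option (Fin 4)) k) P) (X none) := Function.iterate_fixed rn j.val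
  have hX2 : (⇑(conj Φ (sigmaChart 𝒜 (fun i => algebraMap (MvPolynomial (Fin 4) k) (Localization.Away hh) (X ((![0, 1, 2] : Fin 3 → Fin 4) i))) w dbar y hy (sigmaAway σ hσh) hσJ hp hσpL hσy)))^[j.val] ((algebraMap (MvPolynomial (Option (Fin 4)) k) P) (X (some 2))) = (algebraMap (MvPolynomial (Option (Fin 4)) k) P) (X (some 2)) := Function.iterate_fixed r2 j.val
  have hXC : (⇑(conj Φ (sigmaChart 𝒜 (fun i => algebraMap (MvPolynomial (Fin 4) k) (Localization.Away hh) (X ((![0, 1, 2] : Fin 3 → Fin 4) i))) w dbar y hy (sigmaAway σ hσh) hσJ hp hσpL hσy)))^[j.val] ((algebraMap (MvPolynomial (Option (Fin 4)) k) P) (C e)) = (algebraMap (MvPolynomial (Option (Fin 4)) k) P) (C e) := Function.iterate_fixed (rC e) j.val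
  obtain ⟨g, hg⟩ := QhSym.exists_ringHom_eq_iterate (conj Φ (sigmaChart 𝒜 (fun i => algebraMap (MvPolynomial (Fin 4) k) (Localization.Away hh) (X ((![0, 1, 2] : Fin 3 → Fin 4) i))) w dbar y hy (sigmaAway σ hσh) hσJ hp hσpL hσy)) j.val
  rw [← hg] at hX1 hXn hX2 hXC
  have hh' : Φ ((algebraMap ↥(cobordantAlgebra (fun i => algebraMap (MvPolynomial (Fin 4) k) (Localization.Away hh) (X ((![0, 1, 2] : Fin 3 → Fin 4) i))) w) (ChartRing 𝒜 (fun i => algebraMap (MvPolynomial (Fin 4) k) (Localization.Away hh) (X ((![0, 1, 2] : Fin 3 → Fin 4) i))) w dbar y hy)) ((algebraMap (Localization.Away hh) ↥(cobordantAlgebra (fun i => algebraMap (MvPolynomial (Fin 4) k) (Localization.Away hh) (X ((![0, 1, 2] : Fin 3 → Fin 4) i))) w) (algebraMap (MvPolynomial (Fin 4) k) (Localization.Away hh) (C e))) * (cobordantAlgebra.u' (fun i => algebraMap (MvPolynomial (Fin 4) k) (Localization.Away hh) (X ((![0, 1, 2] : Fin 3 → Fin 4) i))) w 1) + 2 * (cobordantAlgebra.s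 (fun i => algebraMap (MvPolynomial (Fin 4) k) (Localization.Away hh) (X ((![0, 1, 2] : Fin 3 → Fin 4) i))) w) * (cobordantAlgebra.u' (fun i => algebraMap (MvPolynomial (Fin 4) k) (Localization.Away hh) (X ((![0, 1, 2] : Fin 3 → Fin 4) i))) w 2) - 3 * (cobordantAlgebra.s (fun i => algebraMap (MvPolynomial (Fin 4) k) (Localization.Away hh) (X ((![0, 1, 2] : Fin 3 → Fin 4) i))) w) * (cobordantAlgebra.u' (fun i => algebraMap (MvPolynomial (Fin 4) k) (Localization.Away hh) (X ((![0, 1, 2] : Fin 3 → Fin 4) i))) w 1) ^ 2 : ↥(cobordantAlgebra (fun i => algebraMap (MvPolynomial (Fin 4) k) (Localization.Away hh) (X ((![0, 1, 2] : Fin 3 → Fin 4) i))) w))) = (algebraMap (MvPolynomial (Option (Fin 4)) k) P) (C e) * (algebraMap (MvPolynomial (Option (Fin 4)) k) P) (X (some 1)) + 2 * (algebraMap (MvPolynomial (Option (Fin 4)) k) P) (X none) * (algebraMap (MvPolynomial (Option (Fin 4)) k) P) (X (some 2)) - 3 * (algebraMap (MvPolynomial (Option (Fin 4)) k) P) (X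 none) * (algebraMap (MvPolynomial (Option (Fin 4)) k) P) (X (some 1)) ^ 2 := by
    simp only [map_sub, map_add, map_mul, map_pow, map_ofNat, hu2, hu1, hΦs, hce]
  rw [QhSym.map_algebraMap_iterate_sigmaR (hσy := hσy), ← hg, hh']
  simp only [map_sub, map_add, map_mul, map_pow, map_natCast, map_ofNat, hX1, hXn, hX2, hXC]

end Summit.ResolutionOfSingularities.ResolutionOfSingularities.Theorems.WildQuotientResolution.S1.KillCert.QhAway

end
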